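import Literature.NumberTheory.Transcendental.OkadaLinearIndependenceProofs
import Literature.NumberTheory.Irrationality.DirichletLValues.ChowlaMilnorSpaceProofs
import HarnessLib

/-!
# Chowla's question at the integers `k > 1`, I: eq. (1), the p. 1329 display, and Chowla–Chowla ⟺ Milnor
# (Gun–Murty–Rath 2011, pp. 1328–1330)

Topic `Literature/NumberTheory/Irrationality/DirichletLValues`. Proofs-only leaf (theorems only, no definition, no
named fact, no `sorry`; cell pub-zeta5, P1 g53) beside `ChowlaMilnor*Proofs.lean` (P1 g50–g52) and the two `L(1, f)`
files of this seat (`LFunctions/PeriodicDirichletSeriesAtOne.lean`, `Transcendental/ChowlaOddPeriodicProofs.lean`).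

## Source (read on the page)

S. Gun, M. R. Murty, P. Rath, *On a conjecture of Chowla and Milnor*, Canad. J. Math. **63** (2011) 1328–1344
[GunRammurtyRath2011]:

* p. 1328, eq. (1): «`L(s, f) = q^{−s} Σ_{a=1}^{q} f(a) ζ(s, a/q)`».
* p. 1329: «**Conjecture (Chowla–Chowla)** Let `p` be any prime and `f` be any rational-valued periodic function with
  period `p`. Then `L(2, f) ≠ 0` except in the case when `f(1) = f(2) = ⋯ = f(p − 1) = f(p)/(1 − p²)`.» …
  «Substituting `(p^k − 1)ζ(k) = Σ_{a=1}^{p−1} ζ(k, a/p)` in the expression (1), we have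
  `L(k, f) = p^{−k} Σ_{a=1}^{p−1} [f(a) + f(p)/(p^k − 1)] ζ(k, a/p)`. Thus the Chowla–Chowla conjecture is clearly
  equivalent to the following conjecture for `k = 2`. **Conjecture (Milnor)** For any integer `k > 1`, the real numbers
  `ζ(k, 1/p), ζ(k, 2/p), …, ζ(k, (p − 1)/p)` are linearly independent over `ℚ`.»
* p. 1330, **Theorem 1**: «Let `k > 1` and `q > 2`, then `dim_ℚ V_k(q) ≥ φ(q)/2`», proved on p. 1332 from Okada's
  **Lemma 1** via eq. (2) `ζ(k, a/q) + (−1)^k ζ(k, 1 − a/q) = ((−1)^{k−1}/(k−1)!) D^{k−1}(π cot πz)|_{z=a/q}`: the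
  `φ(q)/2` numbers `ζ(k, a/q) + (−1)^k ζ(k, 1 − a/q)`, `(a,q) = 1`, `1 ≤ a < q/2`, are `ℚ`-linearly independent
  (tree: `okada_linearIndependent_hurwitzZeta_holds`, P1 g49).

## What is proved (Mathlib's `ZMod.LFunction`; the tree's real `hurwitzValue k x = Σ_{n≥0} (n+x)^{−k}`, `zetaValue`)

* `hurwitzZeta_toAddCircle_natCast` — the bridge `ζ(k, a/N)` (tree, real) `=` Mathlib's `hurwitzZeta (a/N) k`,
  `0 ≤ a ≤ N` (`a = 0` and `a = N` both give `ζ(k)`);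
* `LFunction_natCast_eq_sum_hurwitzValue` — **eq. (1)**: `L(k, Φ) = N^{−k} Σ_{a<N} Φ(a) ζ(k, a/N)` (`ζ(k, 0) := ζ(k)`);
* `pow_mul_LFunction_eq_sum_Ico` — the p. 1329 display for every modulus `N ≥ 2`:
  `N^k L(k, Φ) = Σ_{1 ≤ a < N} (Φ(a) + Φ(0)/(N^k − 1)) ζ(k, a/N)`;
* **`chowlaChowla_iff_milnor`** — for every prime `p` and every `k ≥ 2`: (every `f : ℤ/p → ℚ` with `L(k, f) = 0` is the
  exceptional function `f(a) = f(0)/(1 − p^k)`, `a ≠ 0`) **iff** (`ζ(k, a/p)`, `1 ≤ a < p`, are `ℚ`-linearly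
  independent) — «clearly equivalent», printed for `k = 2`, typed for all `k > 1` (the displayed identity is general);
  both conjectures appear INLINE as the two sides of an iff — they remain OPEN and are not typed as facts;
* (sequel file `ChowlaMilnorParityProofs.lean`: the unconditional parity-`(−1)^k` half via Okada / Theorem 1.)

HONEST FRAMING: reformulations printed in the source made kernel theorems; the Chowla–Chowla, Milnor and Chowla–Milnor
conjectures stay OPEN (they only appear as the two sides of an iff); nothing here concerns `ζ(5)`.
-/

noncomputable section

open Complex Finset HurwitzZeta

namespace Literature.NumberTheory.Irrationality.DirichletLValues

open Literature.NumberTheory.Transcendental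

namespace ChowlaMilnorL

variable {N : ℕ} [NeZero N]

/-! ### Sums over `ℤ/N` as sums over representatives -/

/-- `Σ_{j mod N} F(j) = Σ_{a < N} F(a)`. [folklore] -/
private theorem sum_univ_eq_sum_range {E : Type*} [AddCommMonoid E] (F : ZMod N → E) :
    ∑ j : ZMod N, F j = ∑ a ∈ range N, F (a : ZMod N) := by
  obtain ⟨n, hn⟩ : ∃ n, N = n + 1 := ⟨N - 1, (Nat.succ_pred_eq_of_pos (NeZero.pos N)).symm⟩
  subst hn
  rw [← Fin.sum_univ_eq_sum_range (fun a => F (a : ZMod (n + 1))) (n + 1)]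
  refine Finset.sum_congr rfl fun i _ => ?_
  congr 1
  exact (ZMod.natCast_zmod_val i).symm

/-! ### The bridge between the tree's real `ζ(k, x)` and Mathlib's `hurwitzZeta` -/

/-- For `0 ≤ a ≤ N` and `k ≥ 2`: the tree's real `ζ(k, a/N) = Σ_{n≥0} (n + a/N)^{−k}`, cast to `ℂ`, is Mathlib's
`hurwitzZeta (a/N) k` at the point `toAddCircle (a mod N)` (for `a ∈ {0, N}` both sides are `ζ(k)`: the `n = 0` term
`0^{−k}` vanishes). [cite: GunRammurtyRath2011, §Introduction p. 1328 (definition of ζ(s,x) and eq. (1))] -/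
theorem hurwitzZeta_toAddCircle_natCast {k : ℕ} (hk : 2 ≤ k) {a : ℕ} (ha : a ≤ N) :
    hurwitzZeta (ZMod.toAddCircle (a : ZMod N)) k = ((hurwitzValue k ((a : ℝ) / N) : ℝ) : ℂ) := by
  have hs : 1 < (k : ℂ).re := by simp; omega
  have hN : (0 : ℝ) < N := by exact_mod_cast Nat.pos_of_ne_zero (NeZero.ne N)
  have hx : ((a : ℝ) / N : ℝ) ∈ Set.Icc (0 : ℝ) 1 :=
    ⟨by positivity, div_le_one_of_le₀ (by exact_mod_cast ha) hN.le⟩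
  rw [ZMod.toAddCircle_natCast, ← (hasSum_hurwitzZeta_of_one_lt_re hx hs).tsum_eq, hurwitzValue]
  push_cast
  simp only [cpow_natCast]

/-- The same at an arbitrary residue `j`, through its representative `j̃ < N`. [cite: GunRammurtyRath2011, eq. (1) p. 1328] -/
theorem hurwitzZeta_toAddCircle_eq {k : ℕ} (hk : 2 ≤ k) (j : ZMod N) :
    hurwitzZeta (ZMod.toAddCircle j) k = ((hurwitzValue k ((j.val : ℝ) / N) : ℝ) : ℂ) := by
  rw [← hurwitzZeta_toAddCircle_natCast hk (ZMod.val_lt j).le, ZMod.natCast_zmod_val]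

omit [NeZero N] in
/-- `ζ(k, 0) = ζ(k)` in the tree's conventions (the `n = 0` term `0^{−k}` is `0`). [folklore] -/
private theorem hurwitzValue_zero (k : ℕ) : hurwitzValue k 0 = zetaValue k := by
  simp [hurwitzValue, zetaValue]

/-! ### Eq. (1): `L(k, Φ) = N^{−k} Σ_a Φ(a) ζ(k, a/N)` -/

/-- **Eq. (1) of Gun–Murty–Rath in the kernel's vocabularies**: for `Φ : ℤ/N → ℂ` and `k ≥ 2`,
`L(k, Φ) = N^{−k} Σ_{a=0}^{N−1} Φ(a) ζ(k, a/N)` with the tree's real `ζ(k, x)` (`ζ(k, 0) = ζ(k)`; the source indexes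
`a = 1, …, q` with `ζ(k, q/q) = ζ(k)` instead). [cite: GunRammurtyRath2011, eq. (1) p. 1328] -/
theorem LFunction_natCast_eq_sum_hurwitzValue {k : ℕ} (hk : 2 ≤ k) (Φ : ZMod N → ℂ) :
    ZMod.LFunction Φ k =
      1 / (N : ℂ) ^ k * ∑ a ∈ range N, Φ (a : ZMod N) * ((hurwitzValue k ((a : ℝ) / N) : ℝ) : ℂ) := by
  rw [ZMod.LFunction, cpow_neg, cpow_natCast, one_div, sum_univ_eq_sum_range]
  congr 1
  refine Finset.sum_congr rfl fun a ha => ?_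
  rw [hurwitzZeta_toAddCircle_natCast hk (Finset.mem_range.mp ha).le]

/-- **The display of p. 1329 for every modulus**: for `N ≥ 2`, `k ≥ 2` and `Φ : ℤ/N → ℂ`,
`N^k · L(k, Φ) = Σ_{1 ≤ a < N} (Φ(a) + Φ(0)/(N^k − 1)) ζ(k, a/N)`, by substituting the distribution relation
`(N^k − 1) ζ(k) = Σ_{a=1}^{N−1} ζ(k, a/N)` (tree `sum_hurwitzValue_div_eq`) into eq. (1).
[cite: GunRammurtyRath2011, p. 1329 (display before Milnor's conjecture)] -/
theorem pow_mul_LFunction_eq_sum_Ico (hN : 2 ≤ N) {k : ℕ} (hk : 2 ≤ k) (Φ : ZMod N → ℂ) :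
    (N : ℂ) ^ k * ZMod.LFunction Φ k =
      ∑ a ∈ Ico 1 N, (Φ (a : ZMod N) + Φ 0 / ((N : ℂ) ^ k - 1)) *
        ((hurwitzValue k ((a : ℝ) / N) : ℝ) : ℂ) := by
  have hN0 : (N : ℂ) ≠ 0 := by exact_mod_cast NeZero.ne N
  have hNk : (N : ℂ) ^ k ≠ 0 := pow_ne_zero _ hN0
  -- `N^k − 1 ≠ 0`
  have hNk1 : (N : ℂ) ^ k - 1 ≠ 0 := by
    have h : (1 : ℝ) < (N : ℝ) ^ k := one_lt_pow₀ (by exact_mod_cast hN) (by omega)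
    have h' : ((N : ℂ) ^ k - 1) = (((N : ℝ) ^ k - 1 : ℝ) : ℂ) := by push_cast; ring
    rw [h']
    exact_mod_cast (sub_pos.mpr h).ne'
  -- the distribution relation `Σ_{1 ≤ a < N} ζ(k, a/N) = (N^k − 1) ζ(k)`
  obtain ⟨n, rfl⟩ : ∃ n, N = n + 1 := ⟨N - 1, by omega⟩
  have hdist : ∑ a ∈ Ico 1 (n + 1), ((hurwitzValue k ((a : ℝ) / (n + 1 : ℕ)) : ℝ) : ℂ) =
      (((n + 1 : ℕ) : ℂ) ^ k - 1) * ((zetaValue k : ℝ) : ℂ) := by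
    have h := sum_hurwitzValue_div_eq (m := n + 1) (k := k) (by omega) hk
    have hI : Finset.Ioc 0 n = Finset.Ico 1 (n + 1) := by
      ext a
      simp only [Finset.mem_Ioc, Finset.mem_Ico]
      omega
    rw [Finset.sum_Ioc_succ_top (by omega : 0 ≤ n), div_self (by positivity : ((n + 1 : ℕ) : ℝ) ≠ 0),
      hurwitzValue_one hk, hI] at h
    have h' : ∑ a ∈ Ico 1 (n + 1), hurwitzValue k ((a : ℝ) / (n + 1 : ℕ)) =
        (((n + 1 : ℕ) : ℝ) ^ k - 1) * zetaValue k := by linear_combination h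
    have h'' := congrArg (fun x : ℝ => (x : ℂ)) h'
    push_cast at h'' ⊢
    exact h''
  -- eq. (1), with the `a = 0` term split off
  rw [LFunction_natCast_eq_sum_hurwitzValue hk, Finset.range_eq_Ico,
    Finset.sum_eq_sum_Ico_succ_bot (by omega : 0 < n + 1)]
  simp only [Nat.cast_zero, zero_div, hurwitzValue_zero, zero_add]
  -- the right-hand side, expanded: `Σ Φ(a)ζ(k,a/N) + (Φ(0)/(N^k−1)) Σ ζ(k,a/N)`
  have hR : ∑ a ∈ Ico 1 (n + 1), (Φ (a : ZMod (n + 1)) + Φ 0 / (((n + 1 : ℕ) : ℂ) ^ k - 1)) *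
        ((hurwitzValue k ((a : ℝ) / (n + 1 : ℕ)) : ℝ) : ℂ) =
      (∑ a ∈ Ico 1 (n + 1), Φ (a : ZMod (n + 1)) * ((hurwitzValue k ((a : ℝ) / (n + 1 : ℕ)) : ℝ) : ℂ)) +
        Φ 0 / (((n + 1 : ℕ) : ℂ) ^ k - 1) *
          ∑ a ∈ Ico 1 (n + 1), ((hurwitzValue k ((a : ℝ) / (n + 1 : ℕ)) : ℝ) : ℂ) := by
    rw [Finset.mul_sum, ← Finset.sum_add_distrib]
    exact Finset.sum_congr rfl fun a _ => by ring
  rw [hR, hdist]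
  field_simp
  ring

end ChowlaMilnorL

open ChowlaMilnorL

/-! ### Chowla–Chowla ⟺ Milnor (p. 1329) -/

/-- **«Thus the Chowla–Chowla conjecture is clearly equivalent to the following conjecture [Milnor]»** (printed for
`k = 2`; the displayed computation, and this theorem, hold for every `k > 1`). For a prime `p` and `k ≥ 2` the
following are equivalent: (CC) every `f : ℤ/pℤ → ℚ` with `L(k, f) = 0` is the exceptional function
`f(a) = f(0)/(1 − p^k)` for all `a ≢ 0`; (M) the `p − 1` real numbers `ζ(k, a/p)`, `1 ≤ a < p`, are linearly independent
over `ℚ`. Both (CC) and (M) are OPEN conjectures; only their equivalence is asserted (via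
`p^k L(k, f) = Σ_{a=1}^{p−1} [f(a) + f(p)/(p^k − 1)] ζ(k, a/p)`).
[cite: GunRammurtyRath2011, p. 1329 (Conjectures (Chowla–Chowla), (Milnor) and the display between them)] -/
theorem chowlaChowla_iff_milnor {p : ℕ} [Fact p.Prime] {k : ℕ} (hk : 2 ≤ k) :
    (∀ f : ZMod p → ℚ, ZMod.LFunction (fun j => ((f j : ℚ) : ℂ)) k = 0 →
        ∀ a : ZMod p, a ≠ 0 → f a = f 0 / (1 - (p : ℚ) ^ k)) ↔
      LinearIndependent ℚ fun a : ↥(Finset.Ico 1 p) => hurwitzValue k (((a : ℕ) : ℝ) / p) := by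
  have hp : 2 ≤ p := (Fact.out : p.Prime).two_le
  have hpk : (1 : ℚ) - (p : ℚ) ^ k ≠ 0 := by
    have h : (1 : ℚ) < (p : ℚ) ^ k := one_lt_pow₀ (by exact_mod_cast hp) (by omega)
    exact (sub_neg.mpr h).ne
  have hpkC : ((p : ℂ)) ^ k - 1 ≠ 0 := by
    have h : (1 : ℝ) < (p : ℝ) ^ k := one_lt_pow₀ (by exact_mod_cast hp) (by omega)
    have h' : ((p : ℂ) ^ k - 1) = (((p : ℝ) ^ k - 1 : ℝ) : ℂ) := by push_cast; ring
    rw [h']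
    exact_mod_cast (sub_pos.mpr h).ne'
  -- the key identity, for rational `f`, read in `ℝ`
  have key : ∀ f : ZMod p → ℚ, ZMod.LFunction (fun j => ((f j : ℚ) : ℂ)) k = 0 ↔
      ∑ a : ↥(Finset.Ico 1 p), (f (a : ℕ) + f 0 / ((p : ℚ) ^ k - 1)) •
        hurwitzValue k (((a : ℕ) : ℝ) / p) = 0 := by
    intro f
    have h1 := pow_mul_LFunction_eq_sum_Ico hp hk (fun j => ((f j : ℚ) : ℂ))
    have hiff : ZMod.LFunction (fun j => ((f j : ℚ) : ℂ)) k = 0 ↔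
        (p : ℂ) ^ k * ZMod.LFunction (fun j => ((f j : ℚ) : ℂ)) k = 0 := by
      rw [mul_eq_zero, or_iff_right (pow_ne_zero _ (by exact_mod_cast (NeZero.ne p)))]
    rw [hiff, h1, Finset.sum_coe_sort (Finset.Ico 1 p)
      (fun a : ℕ => (f (a : ℕ) + f 0 / ((p : ℚ) ^ k - 1)) • hurwitzValue k (((a : ℕ) : ℝ) / p))]
    -- the complex sum is the real sum, cast
    have hcast : ∑ a ∈ Ico 1 p, ((((f (a : ZMod p) : ℚ) : ℂ)) + ((f 0 : ℚ) : ℂ) / ((p : ℂ) ^ k - 1)) *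
        ((hurwitzValue k ((a : ℝ) / p) : ℝ) : ℂ) =
        ((∑ a ∈ Ico 1 p, (f (a : ℕ) + f 0 / ((p : ℚ) ^ k - 1)) • hurwitzValue k (((a : ℕ) : ℝ) / p) : ℝ) : ℂ) := by
      push_cast
      refine Finset.sum_congr rfl fun a _ => ?_
      rw [Rat.smul_def]
      push_cast
      ring
    rw [hcast, Complex.ofReal_eq_zero]
  constructor
  · -- (CC) ⇒ (M)
    intro hCC
    rw [Fintype.linearIndependent_iff]
    intro g hg
    classical
    -- extend `g` to a function on `ℤ/p` vanishing at `0`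
    set f : ZMod p → ℚ := fun j => if h : j.val ∈ Finset.Ico 1 p then g ⟨j.val, h⟩ else 0 with hf
    have hf0 : f 0 = 0 := by simp [hf]
    have hfa : ∀ a : ↥(Finset.Ico 1 p), f ((a : ℕ) : ZMod p) = g a := by
      intro a
      have ha := Finset.mem_Ico.mp a.2
      have hval : (((a : ℕ) : ZMod p)).val = (a : ℕ) := ZMod.val_cast_of_lt ha.2
      simp only [hf, hval]
      rw [dif_pos a.2]
    have hL : ZMod.LFunction (fun j => ((f j : ℚ) : ℂ)) k = 0 := by
      rw [key f]
      simp only [hf0, zero_div, add_zero, hfa]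
      exact hg
    intro a
    have ha := Finset.mem_Ico.mp a.2
    have hne : ((a : ℕ) : ZMod p) ≠ 0 := by
      rw [Ne, ZMod.natCast_eq_zero_iff]
      exact Nat.not_dvd_of_pos_of_lt ha.1 ha.2
    have := hCC f hL _ hne
    rw [hfa a, hf0, zero_div] at this
    exact this
  · -- (M) ⇒ (CC)
    intro hM f hL a ha
    rw [Fintype.linearIndependent_iff] at hM
    have hzero := hM _ ((key f).mp hL)
    have hav : a.val ∈ Finset.Ico 1 p :=
      Finset.mem_Ico.mpr ⟨Nat.pos_of_ne_zero fun h => ha ((ZMod.val_eq_zero a).mp h), ZMod.val_lt a⟩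
    have h := hzero ⟨a.val, hav⟩
    simp only [ZMod.natCast_zmod_val] at h
    have hpk' : (p : ℚ) ^ k - 1 ≠ 0 := fun h0 => hpk (by linear_combination -h0)
    have h' : f a = -(f 0 / ((p : ℚ) ^ k - 1)) := by linear_combination h
    rw [eq_div_iff hpk, h']
    field_simp
    ring

end Literature.NumberTheory.Irrationality.DirichletLValues

end
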